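import Summits.QuantumFields.BalabanUV.Beta.EriceFlowEnclosureB12AsPrintedPointwiseFadingLimitFloors

/-!
# Beta / EriceFlowEnclosureB12AsPrintedPointwiseFadingLimitCarrier — WHAT (0.31) FORCES, part 11g: THE ASYMPTOTIC CONSTANT IS THE SUPREMUM OF crew CAP's CERTIFIABLE AVERAGED SLOPES.
# Socket e3 of the R4-CAP road consumes the averaged-AF carrier `Beta.AveragedAFCarrier.BetaAvgAFH s D γ β` (window sums of the β-functions along every ]0,γ]-history are ≥ s·(n − k) − D); the CAP
# crew certifies slices of it with explicit slopes s.  Under node U2's moduli `HistLipschitz ∕ FadingMemory` + NE4 `ScaleShiftRate` (0 ≤ θ < 1) part 11's number `b⋆ = lim_{u→0⁺} betaInf β (u,u,…)`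
# governs these slopes exactly: §1 **`slope_le_bstar_of_betaAvgAFH`** — EVERY slope s of a carrier slice on ANY box ]0, δ₀] ⊆ ]0, γ], with ANY defect D, satisfies **`s ≤ b⋆`** (read the slice along the constant
# history u ≤ δ₀: Cesàro ≥ s, NE4 pins the Cesàro mean to `betaInf β (u,u,…)`, u → 0⁺; only NE4 + `hb` are used); §2 **`betaAvgAFH_bstar`** — conversely the moduli + NE4 GIVE the slice
# **`BetaAvgAFH (b⋆ − 2Cδ∕(1−θ)) (c∕(1−θ)²) δ β` on EVERY box `0 < δ ≤ γ`** (part 11's sandwich summed along the window; the NE4 transients `cθ^j∕(1−θ)` sum to the scale-free defect `c∕(1−θ)²` — no threshold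
# index, no sign hypothesis); §3 **`isLUB_avgSlopes`** — hence `b⋆` is the least upper bound of {s : `BetaAvgAFH s D δ β` for some defect D on some box δ ≤ γ}: the carrier is available with every slope
# `s < b⋆` and with no slope `s > b⋆`.  With part 11a′ (`isLUB_floors`) and 11b (`exists_sharp031`): near zero coupling the eventual floor, the averaged slope and the sharp (0.31) constant are ONE number.
# For the CAP road this says what a certified slice can at best deliver (its slope is a certified LOWER BOUND for b⋆) and that no certification can exceed b⋆
# (β-flow team, prover 2 = lower ∕ positivity side, unit `b2b-balaban-beta-bflow-p2`, gen 49; ROW AP-I × crew CAP's carrier `Beta.AveragedAFCarrier.BetaAvgAFH` = socket e3)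

HONEST FRAMING (page 1 of everything the β sub-cell writes): discharging `BetaPertH` makes Bałaban's UV stability UNCONDITIONAL — a
real constructive-QFT result; it is NOT the continuum limit and NOT the Clay problem.  HONEST DEPENDENCY (cell reorg 2026-08-19,
verbatim): «continuum YM on T⁴ ⇐ BetaPertH ∧ nine spine estimates (0/9 proved); BetaPertH ⇐ (D1) ∧ (D4) ∧ CAP+tail; G-an2-4 gates
asym, D1 and NE2/3/4.»  THIS MODULE DISCHARGES NOTHING: [folklore] finite-sum ∕ limit calculus for an ABSTRACT `β : FlowStep.HBeta` under node U2's HYPOTHESIS SHAPES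
`T4CouplingMatching.HistLipschitz ∕ FadingMemory ∕ ScaleShiftRate` (NONE printed — [Balaban1987RG1] = T. Bałaban, Commun. Math. Phys. **109** (1987) p. 298 ∕ p. 264; GAPS G-t4-U2-1 ∕ G-t4-U2-2) and crew
CAP's HYPOTHESIS SHAPE `BetaAvgAFH` (for Bałaban's (1.22) every instance is a located UNPRINTED input, BETA-SPEC §7 — here a hypothesis in §1 and a CONCLUSION for an abstract setting in §2); node U2's
`T4BetaStationary.tendsto_betaInf` and parts 11∕11a′ BY NAME.  `b⋆` is a real with a displayed property.  Nothing of Bałaban's objects is asserted; no certificate of the CAP crew is used or produced.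

WHAT THIS FILE PROVES (0 sorry, 0 def): §1 `cesaro_const_ge_of_betaAvgAFH` (`s ≤ betaInf β (u,u,…)` for u in the slice's box), **`slope_le_bstar_of_betaAvgAFH`** (`s ≤ b⋆`); §2 `sum_geom_transient_le`
(`Σ_{j∈[k,n)} cθ^j∕(1−θ) ≤ c∕(1−θ)²`), **`betaAvgAFH_bstar`** (`BetaAvgAFH (b⋆ − 2Cδ∕(1−θ)) (c∕(1−θ)²) δ β`); §3 **`isLUB_avgSlopes`**.
NOT CLAIMED: any slice, slope, modulus or scale-shift rate for Bałaban's β; any CAP certificate; Theorem 2; `BetaPertH`; continuum; Clay.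
-/

namespace Summit.QuantumFields.BalabanUV.Beta.EriceFlowEnclosureB12AsPrintedPointwiseFadingLimitCarrier

open Finset Filter Topology
open Literature.MathematicalPhysics.QuantumFieldTheory.Balaban1983to89
open Literature.MathematicalPhysics.QuantumFieldTheory.Balaban1983to89.FlowStep (HBeta prefixOf Box mem_box box_mono)
open Literature.MathematicalPhysics.QuantumFieldTheory.Balaban1983to89.T4CouplingMatching (HistLipschitz FadingMemory ScaleShiftRate)
open Literature.MathematicalPhysics.QuantumFieldTheory.Balaban1983to89.T4BetaStationary (SeqBox betaInf tendsto_betaInf constant_nonneg_of_scaleShiftRate)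
open Literature.MathematicalPhysics.QuantumFieldTheory.Balaban1983to89.Beta.AveragedAFCarrier (BetaAvgAFH)
open Summit.QuantumFields.BalabanUV.Beta.EriceFlowEnclosureB12AsPrintedPointwiseFadingLimit
open Summit.QuantumFields.BalabanUV.Beta.EriceFlowEnclosureB12AsPrintedPointwiseFadingLimitFloors (le_of_forall_geom)

noncomputable section

variable {β : HBeta} {γ C c θ : ℝ} {Λ : ℕ → ℕ → ℝ}

/-! ## §1 Every certifiable averaged slope is ≤ b⋆ -/

/-- **A carrier slice read along a constant history pins the stationary functional from below.**  `BetaAvgAFH s D δ₀ β`, NE4 `ScaleShiftRate c θ γ β` (0 ≤ θ < 1) with `δ₀ ≤ γ`, and `0 < u ≤ δ₀` ⟹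
`s ≤ betaInf β (u,u,…)`: the window sums `Σ_{j∈[k,k+N)} β_{j+1}(u,…,u) ≥ sN − D` against NE4's `|β_{j+1}(u,…,u) − betaInf β (u,…)| ≤ cθ^k∕(1−θ)` (j ≥ k); N → ∞, then k → ∞.
[cite: Balaban1987RG1, Thm 2 p.259, §1 p.264, §5 p.298] -/
theorem cesaro_const_ge_of_betaAvgAFH (hS : ScaleShiftRate c θ γ β) (hθ0 : 0 ≤ θ) (hθ1 : θ < 1)
    {s D δ₀ : ℝ} (hA : BetaAvgAFH s D δ₀ β) (hδ₀γ : δ₀ ≤ γ) {u : ℝ} (hu : 0 < u) (huδ₀ : u ≤ δ₀) :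
    s ≤ betaInf β (fun _ : ℕ => u) := by
  have h1θ : 0 < 1 - θ := by linarith
  have huγ : u ≤ γ := huδ₀.trans hδ₀γ
  have hc : 0 ≤ c := constant_nonneg_of_scaleShiftRate hS (hu.trans_le huγ)
  set f : ℝ := betaInf β (fun _ : ℕ => u) with hf
  have hconst : ∀ i : ℕ, 0 < (fun _ : ℕ => u) i ∧ (fun _ : ℕ => u) i ≤ δ₀ := fun _ => ⟨hu, huδ₀⟩
  -- for every k and N: sN − D ≤ N (f + cθ^k/(1−θ))
  have hwin : ∀ k N : ℕ, s * N - D ≤ (N : ℝ) * (f + c * θ ^ k / (1 - θ)) := by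
    intro k N
    have h := hA (fun _ => u) hconst k (k + N) (Nat.le_add_right k N)
    have hcast : (((k + N : ℕ) : ℝ) - k) = (N : ℝ) := by push_cast; ring
    rw [hcast] at h
    have hpre : ∀ j : ℕ, prefixOf (fun _ : ℕ => u) j = fun _ : Fin (j + 1) => u := fun j => funext fun i => by simp
    have hup : ∑ j ∈ Ico k (k + N), β j (prefixOf (fun _ : ℕ => u) j) ≤ (N : ℝ) * (f + c * θ ^ k / (1 - θ)) := by
      calc ∑ j ∈ Ico k (k + N), β j (prefixOf (fun _ : ℕ => u) j) = ∑ j ∈ Ico k (k + N), β j (fun _ : Fin (j + 1) => u) :=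
            Finset.sum_congr rfl fun j _ => by rw [hpre j]
        _ ≤ ∑ j ∈ Ico k (k + N), (f + c * θ ^ k / (1 - θ)) := by
            refine Finset.sum_le_sum fun j hj => ?_
            have hkj : k ≤ j := (mem_Ico.mp hj).1
            have h1 := (abs_le.mp (abs_const_sub_betaInf_le hS hθ1 hu huγ j)).2
            have hθj : c * θ ^ j / (1 - θ) ≤ c * θ ^ k / (1 - θ) :=
              div_le_div_of_nonneg_right (mul_le_mul_of_nonneg_left (pow_le_pow_of_le_one hθ0 hθ1.le hkj) hc) h1θ.le
            linarith
        _ = (N : ℝ) * (f + c * θ ^ k / (1 - θ)) := by rw [Finset.sum_const, Nat.card_Ico, Nat.add_sub_cancel_left, nsmul_eq_mul]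
    linarith
  -- N → ∞ for each k, then k → ∞
  refine le_of_forall_geom (c := c) hθ0 hθ1 fun k => ?_
  refine le_of_forall_pos_le_add fun ε hε => ?_
  obtain ⟨N, hNε⟩ := exists_nat_gt (|D| / ε)
  have hN1 : (0 : ℝ) < N := by
    have : 0 ≤ |D| / ε := by positivity
    exact_mod_cast Nat.pos_of_ne_zero (by rintro rfl; rw [Nat.cast_zero] at hNε; linarith)
  have h := hwin k N
  have hDN : D ≤ ε * N := by
    have := (div_lt_iff₀ hε).mp hNε
    linarith [le_abs_self D]
  have key : s * N ≤ (N : ℝ) * (f + c * θ ^ k / (1 - θ) + ε) := by nlinarith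
  exact le_of_mul_le_mul_left (by linarith [key]) hN1

/-- **EVERY CERTIFIABLE AVERAGED SLOPE IS ≤ b⋆.**  NE4 (0 ≤ θ < 1), part 11's `b⋆` (displayed property `hb`, 0 ≤ C), and a carrier slice `BetaAvgAFH s D δ₀ β` on any box `0 < δ₀ ≤ γ` with any defect ⟹ `s ≤ b⋆`.
So a certified slice of crew CAP's carrier is a certified LOWER BOUND for the asymptotic constant, and no slice can be certified with a slope above it. [cite: Balaban1987RG1, Thm 2 p.259, §1 p.264, §5 p.298] -/
theorem slope_le_bstar_of_betaAvgAFH (hS : ScaleShiftRate c θ γ β) (hθ0 : 0 ≤ θ) (hθ1 : θ < 1) (hC : 0 ≤ C) {bstar : ℝ}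
    (hb : ∀ u : ℝ, 0 < u → u ≤ γ → |betaInf β (fun _ : ℕ => u) - bstar| ≤ C * u / (1 - θ))
    {s D δ₀ : ℝ} (hA : BetaAvgAFH s D δ₀ β) (hδ₀ : 0 < δ₀) (hδ₀γ : δ₀ ≤ γ) : s ≤ bstar := by
  have h1θ : 0 < 1 - θ := by linarith
  have hu : ∀ u : ℝ, 0 < u → u ≤ δ₀ → s ≤ bstar + C * u / (1 - θ) := by
    intro u hu huδ₀
    have h1 := cesaro_const_ge_of_betaAvgAFH hS hθ0 hθ1 hA hδ₀γ hu huδ₀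
    have h2 := (abs_le.mp (hb u hu (huδ₀.trans hδ₀γ))).2
    linarith
  refine le_of_forall_pos_le_add fun ε hε => ?_
  set u : ℝ := min δ₀ (ε * (1 - θ) / (C + 1)) with hudef
  have hu0 : 0 < u := lt_min hδ₀ (by positivity)
  have huδ₀ : u ≤ δ₀ := min_le_left _ _
  have huε : C * u / (1 - θ) ≤ ε := by
    have h1 : u ≤ ε * (1 - θ) / (C + 1) := min_le_right _ _
    have h2 : (C + 1) * u ≤ ε * (1 - θ) := by rwa [le_div_iff₀ (by positivity), mul_comm] at h1
    rw [div_le_iff₀ h1θ]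
    nlinarith [hu0.le]
  linarith [hu u hu0 huδ₀]

/-! ## §2 Conversely the moduli + NE4 give the slice with slope `b⋆ − 2Cδ∕(1−θ)` and the scale-free defect `c∕(1−θ)²` -/

/-- The NE4 transients along a window sum to a scale-free constant: `Σ_{j∈[k,n)} cθ^j∕(1−θ) ≤ c∕(1−θ)²` (c ≥ 0, 0 ≤ θ < 1). [folklore] -/
theorem sum_geom_transient_le (hθ0 : 0 ≤ θ) (hθ1 : θ < 1) (hc : 0 ≤ c) (k n : ℕ) :
    ∑ j ∈ Ico k n, c * θ ^ j / (1 - θ) ≤ c / (1 - θ) ^ 2 := by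
  have h1θ : 0 < 1 - θ := by linarith
  have hgeom : ∑ j ∈ Ico k n, θ ^ j ≤ 1 / (1 - θ) := by
    calc ∑ j ∈ Ico k n, θ ^ j ≤ ∑ j ∈ range n, θ ^ j := by
          refine Finset.sum_le_sum_of_subset_of_nonneg (fun j hj => mem_range.mpr (mem_Ico.mp hj).2) fun j _ _ => pow_nonneg hθ0 j
      _ ≤ 1 / (1 - θ) := by
          have h := geom_sum_Ico_le_of_lt_one (m := 0) (n := n) hθ0 hθ1
          rw [Nat.Ico_zero_eq_range, pow_zero] at h
          exact h
  calc ∑ j ∈ Ico k n, c * θ ^ j / (1 - θ) = c / (1 - θ) * ∑ j ∈ Ico k n, θ ^ j := by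
        rw [Finset.mul_sum]; exact Finset.sum_congr rfl fun j _ => by ring
    _ ≤ c / (1 - θ) * (1 / (1 - θ)) := mul_le_mul_of_nonneg_left hgeom (by positivity)
    _ = c / (1 - θ) ^ 2 := by field_simp

/-- **THE MODULI + NE4 GIVE THE CARRIER SLICE NEAR b⋆.**  `HistLipschitz Λ γ β` + `FadingMemory C θ Λ` + `ScaleShiftRate c θ γ β` (0 ≤ θ < 1, 0 ≤ C), `b⋆` with `hb`, `0 < δ ≤ γ` ⟹
`BetaAvgAFH (b⋆ − 2Cδ∕(1−θ)) (c∕(1−θ)²) δ β`: along every ]0, δ]-history each β_{j+1} is ≥ `b⋆ − 2Cδ∕(1−θ) − cθ^j∕(1−θ)` (part 11's sandwich) and the transients sum to ≤ `c∕(1−θ)²`.  No threshold index,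
no sign hypothesis, no Theorem 2. [cite: Balaban1987RG1, Thm 2 p.259, §1 p.264, §5 p.298] -/
theorem betaAvgAFH_bstar (hL : HistLipschitz Λ γ β) (hΛ : FadingMemory C θ Λ) (hS : ScaleShiftRate c θ γ β)
    (hθ0 : 0 ≤ θ) (hθ1 : θ < 1) (hC : 0 ≤ C) {bstar : ℝ}
    (hb : ∀ u : ℝ, 0 < u → u ≤ γ → |betaInf β (fun _ : ℕ => u) - bstar| ≤ C * u / (1 - θ))
    {δ : ℝ} (hδ : 0 < δ) (hδγ : δ ≤ γ) :
    BetaAvgAFH (bstar - 2 * C * δ / (1 - θ)) (c / (1 - θ) ^ 2) δ β := by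
  intro g hg k n hkn
  have hc : 0 ≤ c := constant_nonneg_of_scaleShiftRate hS (hδ.trans_le hδγ)
  have hterm : ∀ j ∈ Ico k n, bstar - 2 * C * δ / (1 - θ) - c * θ ^ j / (1 - θ) ≤ β j (prefixOf g j) := by
    intro j _
    have hbox : prefixOf g j ∈ Box δ j := mem_box.mpr fun i => hg i
    have h := (abs_le.mp (abs_beta_sub_bstar_le hL hΛ hS hθ0 hθ1 hC hb hδ hδγ hbox)).1
    linarith
  have hsum := Finset.sum_le_sum hterm
  rw [Finset.sum_sub_distrib, Finset.sum_const, Nat.card_Ico, nsmul_eq_mul, Nat.cast_sub hkn] at hsum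
  have htrans := sum_geom_transient_le hθ0 hθ1 hc k n
  linarith

/-! ## §3 `b⋆` is the least upper bound of the certifiable averaged slopes near zero -/

/-- **`b⋆` IS THE SUPREMUM OF THE CERTIFIABLE AVERAGED SLOPES.**  Under the moduli + NE4 (0 ≤ θ < 1, 0 ≤ C, 0 < γ) and with part 11's `b⋆`: the set of slopes `s` for which crew CAP's carrier
`BetaAvgAFH s D δ β` holds with SOME defect D on SOME box `0 < δ ≤ γ` has least upper bound `b⋆` (§1 upper bound; §2 slopes `b⋆ − 2Cδ∕(1−θ)` for every δ).  With parts 11a′∕11b: eventual floors,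
averaged slopes and the sharp (0.31) constant agree near zero coupling. [cite: Balaban1987RG1, Thm 2 p.259, §1 p.264, §5 p.298] -/
theorem isLUB_avgSlopes (hL : HistLipschitz Λ γ β) (hΛ : FadingMemory C θ Λ) (hS : ScaleShiftRate c θ γ β)
    (hθ0 : 0 ≤ θ) (hθ1 : θ < 1) (hC : 0 ≤ C) (hγ : 0 < γ) {bstar : ℝ}
    (hb : ∀ u : ℝ, 0 < u → u ≤ γ → |betaInf β (fun _ : ℕ => u) - bstar| ≤ C * u / (1 - θ)) :
    IsLUB {s : ℝ | ∃ δ : ℝ, 0 < δ ∧ δ ≤ γ ∧ ∃ D : ℝ, BetaAvgAFH s D δ β} bstar := by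
  have h1θ : 0 < 1 - θ := by linarith
  refine ⟨fun s ⟨δ, hδ, hδγ, D, hA⟩ => slope_le_bstar_of_betaAvgAFH hS hθ0 hθ1 hC hb hA hδ hδγ, fun x hx => ?_⟩
  refine le_of_forall_pos_le_add fun ε hε => ?_
  -- the slope b⋆ − 2Cδ/(1−θ) ≥ b⋆ − ε is certifiable for small δ
  set δ : ℝ := min γ (ε * (1 - θ) / (2 * (C + 1))) with hδdef
  have hδ : 0 < δ := lt_min hγ (by positivity)
  have hδγ : δ ≤ γ := min_le_left _ _
  have hδε : 2 * C * δ / (1 - θ) ≤ ε := by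
    have h1 : δ ≤ ε * (1 - θ) / (2 * (C + 1)) := min_le_right _ _
    have h2 : 2 * (C + 1) * δ ≤ ε * (1 - θ) := by rwa [le_div_iff₀ (by positivity), mul_comm] at h1
    rw [div_le_iff₀ h1θ]
    nlinarith [hδ.le]
  have hmem : bstar - 2 * C * δ / (1 - θ) ∈ {s : ℝ | ∃ δ : ℝ, 0 < δ ∧ δ ≤ γ ∧ ∃ D : ℝ, BetaAvgAFH s D δ β} :=
    ⟨δ, hδ, hδγ, c / (1 - θ) ^ 2, betaAvgAFH_bstar hL hΛ hS hθ0 hθ1 hC hb hδ hδγ⟩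
  linarith [hx hmem]

end

end Summit.QuantumFields.BalabanUV.Beta.EriceFlowEnclosureB12AsPrintedPointwiseFadingLimitCarrier
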